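import Summits.FinalStateConjecture.FinalStateConjecture.Theses.PhaseMixingCapture
import Summits.FinalStateConjecture.FinalStateConjecture.Theses.SwallowTheDatum
import Summits.FinalStateConjecture.FinalStateConjecture.Theorems.PhotonSphereChannelsTameCensorshipReduction
import Summits.FinalStateConjecture.FinalStateConjecture.Theorems.SwallowTheDatumTargetGlue
import Summits.FinalStateConjecture.FinalStateConjecture.Theorems.WeakCosmicCensorshipMGHD.Negative.TruncatedMinkowski
import Literature.Geometry.Lorentzian.StabilityCauchy
import Literature.Geometry.Lorentzian.LeviCivitaProofs
import Literature.Geometry.Lorentzian.IPlusRegular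

/-!
# Line `stability-certified-burial` — skeleton for the crux
# `PhaseMixingCapture.WeakCosmicCensorshipMGHD` (item stmt-FinalStateConjecture-9952)

Planner seat `cruxplan-stmt-FinalStateConjecture-9952-stability-certified-`, round 1, 2026-08-16.
Idea card `Cruxes/WeakCosmicCensorshipMGHD/Ideas/stability-certified-burial.md` (ideator 1; passed by
all three triagers as the distinct cluster C), sharpened by `TRIAGE-r1-{1,2,3}.md`:
(T1) homothety-normalise every member to ONE reference triple `(M, a, r₀) = (1, 0, 1)` so that a
single Klainerman–Szeftel ball is consumed; (T2)/(T3) TYPE the slice-change transfer in far-origin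
form; (A4) local families suffice.

## The line (W = the crux)

A member `F c`, `c ≠ 0`, of the burial family through `d` need NOT be exactly Kerr anywhere near the
hole: outside a compact core it carries a NEAR-Schwarzschild Kerr–Schild COLLAR (an open condition)
continued by an exact, bent (Boyer–Lindquist) Schwarzschild far end — `stub_collaredFamily`, the
ε-tolerant two-scale gluing at the FIXED datum `d` (the idea's engine; XL; HARDEST).  In EVERY
maximal development `𝒟` of such a member sits the SHADOW LEAF `σ : Kerr.slice 0 1 → 𝒟`: the
member's own collar continued, below the bent data hypersurface, by the flat Kerr–Schild leaf
`t* = 0` of the exact far region — `stub_shadowLeaf` (explicit Schwarzschild causal geometry +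
exterior ignorance for the exact far sub-datum, item 10053; L), which also delivers the two causal
side conditions of the transfer (backward capture of far rays by far leaf origins, pre-segments
outside the relevant futures).  The leaf's induced datum is, up to the homothety `Λ = M(c)`, a
vacuum datum `D̂` on `Kerr.slice 0 1`, `η`-close to `Kerr.data 1 0 1` and EQUAL to it far out.
Generalised exterior ignorance — `stub_shadowDevelopment` (L) — makes the leaf's own Cauchy
development inside `𝒟` a MAXIMAL development of `D̂`, homothetically embedded over `σ`; the
certificate `stub_leafCapture` (= the vendored Klainerman–Szeftel Cauchy fact at `(1, 0, 1)`, also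
the `a₁ = 0` instance of the route's own rank-4 crux `BulkKerrCapture` — both reductions PROVED
below, sorry-free) says every maximal development of such a `D̂` has complete `𝓘⁺` from far leaf
origins; `stub_leafScriTransfer` (M–L) lifts this along the homothetic embedding and the backward
capture to all-origin completeness of `𝓘⁺` of `𝒟` from `ι(X)`.  MGHD existence on admissible data
is the shared item `MGHDExists` (9937); local families suffice
(`isChristodoulouGeneric_one_of_local`, landed).  `WeakCosmicCensorshipMGHD_of` composes the five
stubs and the two shared items into the crux BY NAME (pure logic, no `sorry`).

LOAD-BEARING / HARDEST stub: `stub_collaredFamily`.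

## Disproof used (`Cruxes/WeakCosmicCensorshipMGHD/Disproof.lean`, cdisprove rev of 2026-08-16: RESISTS)

* No `_false_without_<H>` theorem is landed for this crux. §4(c)/§8 + the landed
  `Theorems/WeakCosmicCensorshipMGHD/Negative/TruncatedMinkowski.lean` (imported here):
  `IsMaximal` is load-bearing — honoured: `stub_shadowLeaf` and `stub_shadowDevelopment` take
  `𝒟.IsMaximal`, the certificate concludes only for maximal developments of the leaf datum, and no
  stub asserts completeness of a non-maximal development (the transfer stub concludes for the given
  `𝒟` only under the embedded far-complete development hypothesis).
* §4(b) + `Negative/LoadBearing.lean`: `[T2Space X]` kept in every `X`-quantifier.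
* §3: the `∃ ∧ ∀` bundling — the `∃` conjunct is fed by `MGHDExists` (9937), the `∀` conjunct by the
  per-MGHD shadow leaf; no isometry-invariance hypothesis is needed.
* §7 (local families suffice): used, via the landed
  `Theorems.PhotonSphereChannels.isChristodoulouGeneric_one_of_local`.
* §9/§10 + `Negative/GenericityComplement.lean`: the line is a burial line and says so; it proves the
  crux AS TYPED.
* `ledger negatives --problem FinalStateConjecture`: none bears on these stubs (checked 2026-08-16).
-/

set_option linter.dupNamespace false

noncomputable section

namespace Summit.FinalStateConjecture.FinalStateConjecture.Cruxes.WeakCosmicCensorshipMGHD.StabilityCertifiedBurial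

open scoped Manifold ContDiff Topology ENNReal
open Bundle Set Function Literature.Geometry.Lorentzian
open Summit.FinalStateConjecture.FinalStateConjecture.Theses.PhaseMixingCapture (WeakCosmicCensorshipMGHD BulkKerrCapture)
open Summit.FinalStateConjecture.FinalStateConjecture.Theses.SwallowTheDatum (SubdataDevelopmentsEmbed MGHDExists)

/-! ## Vocabulary (all over existing tree declarations) -/

section Vocabulary

/-- The **far bent height** of the member's data hypersurface in unit-mass Schwarzschild
Kerr–Schild coordinates: `T(r) = 0` for `r ≤ Rb` (the data slice IS the leaf `t* = 0` on the whole
collar), and for `r ≥ 2 Rb` the Boyer–Lindquist height `2 log(r − 2) + const` (so the far end is a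
`t_BL = const` slice: isotropic, `k = 0`, Dafermos–Rodnianski admissible), `Real.smoothTransition`
in between.  For `Rb ≥ 16` the graph `t* = T(r)` is spacelike with slope `0 ≤ T' ≪ (r+2)/(r−2)`. -/
def farBentHeight (Rb r : ℝ) : ℝ :=
  Real.smoothTransition (r / Rb - 1) * (2 * (Real.log (r - 2) - Real.log (Rb - 2)))

/-- The unit leaf `N = Kerr.slice 0 1 = {t* = 0, r > 1}` of unit-mass Schwarzschild (`r₋ = 0 < 1 < 2 = r₊`:
horizon-penetrating, inner edge inside the hole), the carrier of every normalised leaf datum. -/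
abbrev unitSlice : TopologicalSpace.Opens E3 := Kerr.slice 0 1

/-- Kerr–Schild radius of a point of a slice (`a = 0`: the Euclidean norm). -/
abbrev rad (y : E3) : ℝ := Kerr.radius 0 (E4.ofTimeSpace 0 y)

variable {X : Type} [TopologicalSpace X] [ChartedSpace E3 X] [IsManifold (𝓡 3) ∞ X]

/-- **Collar chart** of the datum `D` on `X` (data level; scale `Λ > 0`, bending radius `Rb ≥ 16`):
`Φ : Kerr.slice 0 1 → X` is a smooth open embedding with COMPACT complement of its range such that
(i) on the collar `{1 < r < Rb}` the pulled-back datum is the `(Λ², Λ)`-homothetic image of the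
NORMALISED LEAF DATUM `D̂` on `Kerr.slice 0 1`; (ii) `D̂` IS the exact Kerr–Schild Schwarzschild datum
`Kerr.data 1 0 1` on `{r > Rb − 1}`; (iii) on `{r > Rb − 1}` the pulled-back datum is the
`(Λ², Λ)`-homothetic image of the data induced by unit Schwarzschild `g_{1,0}` on the bent graph
`t* = farBentHeight Rb r` (spacelike, future unit normal `ν`).  Nothing is said about the compact
core `X ∖ range Φ` (there sits the buried datum). -/
def IsCollarChart [Kerr.Facts] [Kerr.SliceFacts] (D : InitialDataSet (𝓡 3) X) (Λ Rb : ℝ)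
    (Φ : unitSlice → X) (Dh : InitialDataSet 𝓘(ℝ, E3) unitSlice) : Prop :=
  0 < Λ ∧ 16 ≤ Rb ∧
  ContMDiff 𝓘(ℝ, E3) (𝓡 3) ∞ Φ ∧ Topology.IsOpenEmbedding Φ ∧ IsCompact (Set.range Φ)ᶜ ∧
  (∀ y : unitSlice, rad y < Rb →
    pullbackBilin (I := 𝓡 3) (I' := 𝓘(ℝ, E3)) Φ D.h.inner y = Λ ^ 2 • Dh.h.inner y ∧
    pullbackBilin (I := 𝓡 3) (I' := 𝓘(ℝ, E3)) Φ D.k y = Λ • Dh.k y) ∧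
  (∀ y : unitSlice, Rb - 1 < rad y →
    Dh.h.inner y = (Kerr.data 1 0 1 zero_le_one).h.inner y ∧
    Dh.k y = (Kerr.data 1 0 1 zero_le_one).k y) ∧
  ∃ (ψ : unitSlice → Kerr.region 0 1) (ν : NormalField 𝓘(ℝ, E4) ψ),
    (∀ y : unitSlice, (ψ y : E4) = E4.ofTimeSpace (farBentHeight Rb (rad y)) (y : E3)) ∧
    (Kerr.smoothMetric 1 0 1).IsSpacelikeImmersion 𝓘(ℝ, E3) ψ ∧
    (Kerr.smoothMetric 1 0 1).IsFutureUnitNormal 𝓘(ℝ, E3)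
      ((Kerr.timeOrientation 1 0 1 zero_le_one).ofLE le_top) ψ ν ∧
    ∀ y : unitSlice, Rb - 1 < rad y →
      pullbackBilin (I := 𝓡 3) (I' := 𝓘(ℝ, E3)) Φ D.h.inner y =
          Λ ^ 2 • pullbackBilin (I := 𝓘(ℝ, E4)) (I' := 𝓘(ℝ, E3)) ψ (Kerr.smoothMetric 1 0 1).val y ∧
        ∀ [(Kerr.smoothMetric 1 0 1).HasLeviCivita],
          (pullbackBilin (I := 𝓡 3) (I' := 𝓘(ℝ, E3)) Φ D.k y).toLinearMap₁₂ =
            Λ • (Kerr.smoothMetric 1 0 1).secondFundamentalForm 𝓘(ℝ, E3) ψ ν y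

/-- `D` is **near-Kerr collared** at tolerance `(s, δ, η)`: it admits a collar chart whose normalised
leaf datum `D̂` solves the vacuum constraints and is `η`-close to `Kerr.data 1 0 1` in the weighted
Sobolev distance `H^s_δ × H^{s-1}_{δ+1}` of the Klainerman–Szeftel ball (an OPEN condition on the
collar; `D̂ − Kerr.data 1 0 1` is smooth and supported in `{r ≤ Rb − 1}`, so every `(s, δ)` is met by
`C^s`-smallness). -/
def IsNearKerrCollared [Kerr.Facts] [Kerr.SliceFacts] (s : ℕ) (δ η : ℝ)
    (D : InitialDataSet (𝓡 3) X) : Prop :=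
  ∃ (Λ Rb : ℝ) (Φ : unitSlice → X) (Dh : InitialDataSet 𝓘(ℝ, E3) unitSlice),
    IsCollarChart D Λ Rb Φ Dh ∧
    (∀ [Dh.metric.HasLeviCivita], Dh.IsVacuumConstraintSolution) ∧
    InitialDataSet.dataWeightedSobolevEDist s δ Dh (Kerr.data 1 0 1 zero_le_one) < ENNReal.ofReal η

variable [T2Space X] [SecondCountableTopology X] [ConnectedSpace X]

/-- **Shadow leaf** of the normalised datum `D̂` at scale `Λ` inside the vacuum Cauchy development
`𝒟` of `D`: a smooth embedding `σ : Kerr.slice 0 1 → 𝒟` with future unit normal `νσ`, ACAUSAL range,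
inducing the `(Λ², Λ)`-homothetic image of `D̂` (`σ^* g = Λ² ĥ`, `K_{νσ} = Λ k̂`), lying in the
causal past of the data hypersurface `ι(X)`, and satisfying BACKWARD CAPTURE: for all compact
`K₀, K₁ ⊆ Kerr.slice 0 1` there is a compact `B₁ ⊆ X` such that every normalised future null ray
`γ` of `𝒟` from `ι x`, `x ∉ B₁`, passes at some parameter `t₀ ≤ 0` through a FAR leaf point `σ q`
(`q` in the closed far region `{‖y‖ ≥ R + 1}`, `q ∉ K₁`) with normalisation factor
`−g(γ̇(t₀), νσ q) ≤ ϰ`, its pre-segment `γ[t₀, 0)` avoiding `J⁺(σ K₀)`. -/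
def HasShadowLeaf {D : InitialDataSet (𝓡 3) X} (𝒟 : VacuumCauchyDevelopment D) (Λ : ℝ)
    (Dh : InitialDataSet 𝓘(ℝ, E3) unitSlice) : Prop :=
  ∃ (σ : unitSlice → 𝒟.carrier) (νσ : NormalField (𝓡 4) σ),
    Manifold.IsSmoothEmbedding (𝓡 3) (𝓡 4) ∞ σ ∧
    𝒟.metric.IsFutureUnitNormal (𝓡 3) 𝒟.timeOrientation σ νσ ∧
    (∀ y : unitSlice, pullbackBilin (I := 𝓡 4) (I' := 𝓡 3) σ 𝒟.metric.val y = Λ ^ 2 • Dh.h.inner y) ∧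
    (∀ [𝒟.metric.toPseudoRiemannianMetric.HasLeviCivita] (y : unitSlice),
      𝒟.metric.toPseudoRiemannianMetric.secondFundamentalForm (𝓡 3) σ νσ y = Λ • Dh.kBilin y) ∧
    𝒟.metric.IsAcausal 𝒟.timeOrientation (Set.range σ) ∧
    (∀ q : unitSlice, σ q ∈ 𝒟.metric.causalPast 𝒟.timeOrientation (Set.range 𝒟.embed)) ∧
    ∃ ϰ : ℝ, 0 < ϰ ∧ ∀ (K₀ K₁ : Set unitSlice), IsCompact K₀ → IsCompact K₁ →
      ∃ B₁ : Set X, IsCompact B₁ ∧ ∀ x : X, x ∉ B₁ →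
        ∀ [𝒟.metric.HasLeviCivita] (γ : ℝ → 𝒟.carrier) (dom : Set ℝ),
          𝒟.metric.IsNormalisedNullRayFrom 𝒟.timeOrientation 𝒟.embed 𝒟.normal x γ dom →
          ∃ t₀ ∈ dom, t₀ ≤ 0 ∧ ∃ q : unitSlice, q ∈ Set.range (Kerr.farSliceIncl 0 1) ∧ q ∉ K₁ ∧
            γ t₀ = σ q ∧
            -(𝒟.metric.val (γ t₀) (velocity (𝓡 4) γ t₀) (νσ q)) ≤ ϰ ∧
            ∀ t ∈ dom, t₀ ≤ t → t < 0 →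
              γ t ∉ 𝒟.metric.causalFuture 𝒟.timeOrientation (σ '' K₀)

end Vocabulary

/-! ## The five stub statements -/

/-- **Stub 1 — `stub_collaredFamily` (the ε-TOLERANT BURIAL; XL; HARDEST; the idea's engine).**
For every tolerance `(s, δ, η)` and every admissible datum `d` on `X` there is a jointly smooth
one-parameter family `F` through `d` which, for small parameters `|c| < ε` only (local families
suffice, Disproof §7), is injective and admissible, and whose members `F c`, `c ≠ 0`, are near-Kerr
collared at tolerance `(s, δ, η)`.
Engine (card §(3), sharpened): background = a one-ended complete AF VACUUM datum on `ℝ³` which is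
EXACT unit-mass Schwarzschild in ingoing Kerr–Schild form on `{r > r_cap}`, `r_cap < 1` (depth `M`
inside the hole, reached by re-slicing a Li–Mei / Li–Yu vacuum collapse development later —
the `a = 0`, `r₁ = M` instance of the sibling crux `KerrShieldedDataExist`, stmt-10055), sliced by
`t* = farBentHeight Rb r` outside; (i) BODY SCALE at the FIXED `d` (units of `d`, `ε = 1/Λ`):
Newton/IFT for `Φ(d + χ_ε w_ε + v) = 0` in Bartnik's weighted phase space (constraint map a
submersion at AF data, no cokernel; constants of `d` alone), `w_ε` = the background's tidal jet at the
burial point cut off at `|x| = ρ₀/ε`, violation `O(ε^{1/2})`, output `O(ε)`-close to the background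
on the matching annulus in background units; (ii) BACKGROUND SCALE: interpolate across the annulus
and remove the `O(ε)` compactly supported constraint violation by ONE Chruściel–Delay /
Corvino–Schoen correction supported in a FIXED compact `K` (annulus ∪ tube to the KID-free cap;
`K ⊆ {r < Rb − 1}`, it MAY cross the collar — this is the tolerance), constants `ε`-uniform; the
collar ends up `O(ε)`-close to `Kerr.data 1 0 1` in every `C^k` and equal to it on `{r > Rb − 1}`;
(iii) transport to the fixed `X` (diffeos `= id` on exhausting compacts), joint smoothness at
`c = 0` by conormal `ε`-dependence + the flat reparametrisation `ε = e^{−1/c²}`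
(`isSmoothDataFamily_of_locally_eq`), local injectivity by the strictly monotone scale `Λ(c)`.
Why it might fail: the conormal (b-regular) joint dependence of the two-scale solve on `ε` is
asserted, not printed; the depth-`M` exact background is the unproved stmt-10055 (`a = 0`); the
`a = 0` exterior needs `J = 0` bookkeeping (reflection-symmetric pulse, or an MOT annular re-gluing).
Leans on: `admissibleVacuumData`, `InitialDataSet.IsSmoothDataFamily`, `Kerr.{slice, region, data,
smoothMetric, timeOrientation, radius}`, `pullbackBilin`, `secondFundamentalForm`,
`InitialDataSet.dataWeightedSobolevEDist`; print: Bartnik gr-qc/0402070 §3, Chruściel–Delay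
gr-qc/0301073, Corvino–Schoen gr-qc/0301071, Beig–Chruściel–Schoen gr-qc/0403042, Li–Mei
arXiv:2005.01249, Mao–Oh–Tao arXiv:2308.13031. -/
def Sig.stub_collaredFamily : Prop :=
  ∀ [Kerr.Facts] [Kerr.SliceFacts] (s : ℕ) (δ η : ℝ), 0 < η →
    ∀ (X : Type) [TopologicalSpace X] [ChartedSpace E3 X] [IsManifold (𝓡 3) ∞ X]
      [T2Space X] [SecondCountableTopology X] [ConnectedSpace X],
      ∀ d ∈ admissibleVacuumData X,
        ∃ (ε : ℝ) (F : EuclideanSpace ℝ (Fin 1) → InitialDataSet (𝓡 3) X), 0 < ε ∧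
          InitialDataSet.IsSmoothDataFamily 1 F ∧ F 0 = d ∧
          (∀ c c' : EuclideanSpace ℝ (Fin 1), |c 0| < ε → |c' 0| < ε → F c = F c' → c = c') ∧
          (∀ c : EuclideanSpace ℝ (Fin 1), |c 0| < ε → F c ∈ admissibleVacuumData X) ∧
          ∀ c : EuclideanSpace ℝ (Fin 1), c ≠ 0 → |c 0| < ε → IsNearKerrCollared s δ η (F c)

/-- **Stub 2 — `stub_shadowLeaf` (the SHADOW LEAF inside every MGHD of a collared admissible datum,
with the two causal side conditions of the transfer; L; explicit Schwarzschild geometry).**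
Given exterior ignorance for sub-data (`SubdataDevelopmentsEmbed`, shared item stmt-10053): if `D`
is admissible on `X` with collar chart `(Λ, Rb, Φ, D̂)`, then every maximal vacuum Cauchy development
`𝒟` of `D` has a shadow leaf of `D̂` at scale `Λ` (`HasShadowLeaf`).
Construction: the far sub-datum `D.comap (Φ| {r > Rb − 1})` is the `Λ`-scaled bent Schwarzschild
slice; its explicit development `W` = the interior of the domain of dependence of the graph
`t* = Λ·farBentHeight Rb (r/Λ)` in mass-`Λ` Kerr–Schild Schwarzschild (`Kerr.smoothMetric Λ 0 _`,
Ricci-flat: `Kerr.isRicciFlat` at `a = 0`, proof in progress in `SchwarzschildKerrSchild*.lean`)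
embeds into `𝒟` by 10053 (`χ_W`); set `σ := ι ∘ Φ` on `{r < Rb}` and `σ := χ_W ∘ (y ↦ (0, Λy))` on
`{r > Rb − 1}` (they agree on the overlap, where the height vanishes); the leaf `{t* = 0, r > Rb − 1}`
lies in `D⁻` of the far slice piece (past Cauchy horizon `t* = (Rb − 1 − r)Λ < 0`), strictly in
`I⁻(ιX)` beyond `Rb`.  Induced data `= (Λ², Λ)·D̂` by the collar clauses and `Kerr.data = (sliceEmbed)^* g`.
ACAUSALITY: `t*` is a time function on the exact region, the inner part lies on the acausal Cauchy
surface `ι(X)`, and a future causal curve from a far leaf point `(0, r_f)` first meets the slice at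
radius `> Rb` (`r(t*) ≥ r_f − t*` and `T = 0` below `Rb`), after which it cannot return to `ι(X)`.
BACKWARD CAPTURE (far Schwarzschild arithmetic, `M = Λ`): a normalised ray from `ι x`, `r_x ≫ 1`,
extended to the past stays in the exact sandwich and meets `t* = 0` at radius
`r̃ ∈ [r_x − 3M log r_x, r_x + T(r_x)]`; `−g(γ̇, νσ) ≤ 2` there (conserved Killing energy `≈ 1`,
both normals `O(M/r)`-close to static); the pre-segment lives at `t* ≤ T(r_x) ≈ 2M log r_x` and
radii `≥ r_x − 3M log r_x`, outside `J⁺(σ K₀) ⊆ J⁺(ιX) ∪ {t* ≥ r − R(K₀) − C}`; `B₁ := X ∖ Φ{r > R₂}`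
is compact because `(X, h)` is COMPLETE (admissibility is load-bearing, cf. 10054 TRIAGE-r1-2 §H1).
Why it might fail: only through a typing slip in `HasShadowLeaf` (e.g. if the causal past / acausality
predicates of the prelude were mis-oriented) or if `farBentHeight` failed to be spacelike for some
`Rb ≥ 16` (slope bound `T' ≤ (C_ST/Rb)·2 log 3 + 2/(Rb − 2) ≪ (r+2)/(r−2)`).
Leans on: `SubdataDevelopmentsEmbed`, `InitialDataSet.comap`, `Kerr.{region, smoothMetric,
timeOrientation, sliceEmbed, sliceNormal, farSliceIncl}`, `Kerr.isRicciFlat` (a = 0),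
`isComplete_of_mem_admissibleVacuumData`, `LorentzianMetric.{IsAcausal, causalPast, causalFuture,
IsNormalisedNullRayFrom}`; print: O'Neill 1983 Ch. 14 (Lemmas 14.29–14.43), Hawking–Ellis §6.5–6.6,
Dafermos–Rodnianski arXiv:0811.0354 §2.6.2/§5.1. -/
def Sig.stub_shadowLeaf : Prop :=
  SubdataDevelopmentsEmbed →
  ∀ [Kerr.Facts] [Kerr.SliceFacts] (X : Type) [TopologicalSpace X] [ChartedSpace E3 X]
    [IsManifold (𝓡 3) ∞ X] [T2Space X] [SecondCountableTopology X] [ConnectedSpace X]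
    (D : InitialDataSet (𝓡 3) X) (Λ Rb : ℝ) (Φ : unitSlice → X)
    (Dh : InitialDataSet 𝓘(ℝ, E3) unitSlice),
    D ∈ admissibleVacuumData X → IsCollarChart D Λ Rb Φ Dh →
    ∀ 𝒟 : VacuumCauchyDevelopment D, 𝒟.IsMaximal → HasShadowLeaf 𝒟 Λ Dh

/-- **Stub 3 — `stub_shadowDevelopment` (GENERALISED EXTERIOR IGNORANCE, homothetic form, with the
MGHD of the leaf datum for free; L).**  Let `𝒟` be a MAXIMAL vacuum Cauchy development of `(X, D)`
and `σ : N → 𝒟` a smooth embedding of a connected Hausdorff second-countable `3`-manifold with future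
unit normal `νσ`, ACAUSAL range, inducing the `(Λ², Λ)`-homothetic image of a datum `D̂` on `N`
(`Λ > 0`).  Then `D̂` has a MAXIMAL vacuum Cauchy development `𝒟σ` together with a smooth,
time-orientation preserving, `Λ²`-HOMOTHETIC open embedding `χ : 𝒟σ → 𝒟` over `σ` (`χ ∘ ισ = σ`).
Proof plan: `𝒟σ := (int D_𝒟(σ N), Λ⁻² g, τ, σ, Λ νσ)` — `σ(N)` is an acausal topological hypersurface
with `edge ∩ σ(N) = ∅`, hence a Cauchy hypersurface of the (open, globally hyperbolic, Ricci-flat)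
interior of its domain of dependence (O'Neill 14.38/14.43; `CauchyDevelopmentRestrict`-style
construction); `χ :=` the inclusion.  MAXIMALITY = generalised exterior ignorance: every vacuum Cauchy
development `𝒟''` of `D̂` embeds into `𝒟` over `σ` (maximal common development `U` of `D̂` in
`(𝒟'', 𝒟)`; if `U ≠ 𝒟''`, either a boundary point of `U` has a limit in `𝒟` and local geometric
uniqueness extends `U`, or the gluing `𝒟 ∪_U 𝒟''` is a Hausdorff vacuum Cauchy development of
`(X, D)` strictly containing `𝒟` — contradiction with `𝒟.IsMaximal` via rigidity of self-embeddings,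
`Theorems/SwallowTheDatumSubdataDevelopmentsEmbedRigidity`), and its image, being globally hyperbolic
with Cauchy surface `σ(N)`, lies in `int D(σ N)`.  The case `σ = ι ∘ Φ`, `Λ = 1` is item 10053.
Why it might fail: acausality of `range σ` is the only causal hypothesis (card's honest bet (a); the
triage found no cheap counterexample: hyperboloids/Milne, flat sub-balls, time-symmetric sub-data);
the CBG gluing needs LOCAL GEOMETRIC UNIQUENESS for the vacuum equations (HE §7.5), absent from the
prelude — the same debt as 10053.
Leans on: `VacuumCauchyDevelopment.IsMaximal`, `Manifold.IsSmoothEmbedding`, `pullbackBilin`,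
`secondFundamentalForm`, `LorentzianMetric.IsAcausal`, `TimeOrientation.PreservesTimeOrientation`;
print: Choquet-Bruhat–Geroch 1969 Thm 3, Ringström 2009 Ch. 16, Sbierski 2016 Thm 2.6, O'Neill 1983
Ch. 14. -/
def Sig.stub_shadowDevelopment : Prop :=
  ∀ (X : Type) [TopologicalSpace X] [ChartedSpace E3 X] [IsManifold (𝓡 3) ∞ X]
    [T2Space X] [SecondCountableTopology X] [ConnectedSpace X]
    (D : InitialDataSet (𝓡 3) X) (𝒟 : VacuumCauchyDevelopment D), 𝒟.IsMaximal →
    ∀ (N : Type) [TopologicalSpace N] [ChartedSpace E3 N] [IsManifold (𝓡 3) ∞ N]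
      [T2Space N] [SecondCountableTopology N] [ConnectedSpace N]
      (Dh : InitialDataSet (𝓡 3) N) (σ : N → 𝒟.carrier) (νσ : NormalField (𝓡 4) σ) (Λ : ℝ),
      0 < Λ →
      Manifold.IsSmoothEmbedding (𝓡 3) (𝓡 4) ∞ σ →
      𝒟.metric.IsFutureUnitNormal (𝓡 3) 𝒟.timeOrientation σ νσ →
      (∀ y : N, pullbackBilin (I := 𝓡 4) (I' := 𝓡 3) σ 𝒟.metric.val y = Λ ^ 2 • Dh.h.inner y) →
      (∀ [𝒟.metric.toPseudoRiemannianMetric.HasLeviCivita] (y : N),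
        𝒟.metric.toPseudoRiemannianMetric.secondFundamentalForm (𝓡 3) σ νσ y = Λ • Dh.kBilin y) →
      𝒟.metric.IsAcausal 𝒟.timeOrientation (Set.range σ) →
      ∃ 𝒟σ : VacuumCauchyDevelopment Dh, 𝒟σ.IsMaximal ∧
        ∃ χ : 𝒟σ.carrier → 𝒟.carrier,
          ContMDiff (𝓡 4) (𝓡 4) ∞ χ ∧ Topology.IsOpenEmbedding χ ∧
          (∀ p, pullbackBilin (I := 𝓡 4) (I' := 𝓡 4) χ 𝒟.metric.val p = Λ ^ 2 • 𝒟σ.metric.val p) ∧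
          𝒟σ.timeOrientation.PreservesTimeOrientation χ 𝒟.timeOrientation ∧
          χ ∘ 𝒟σ.embed = σ

/-- **Stub 4 — `stub_leafScriTransfer` (the SLICE-CHANGE TRANSFER in far-origin form; M–L; pure
causal/ODE theory over the prelude).**  Let `𝒟` be a Cauchy development of `(X, D)`, `𝒮` ANY data
embedding of a datum on `N`, `χ : 𝒮 → 𝒟` a smooth, time-orientation preserving, `Λ²`-homothetic open
embedding, `σ := χ ∘ ι'` with a future unit normal `νσ` in `𝒟`.  Suppose `𝒮` has complete `𝓘⁺`
in the sojourn form AS SEEN FROM the origins `A ⊆ N`, the leaf lies in the causal past of `ι(X)`,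
and BACKWARD CAPTURE holds with constant `ϰ` (as in `HasShadowLeaf`).  Then `𝒟` has complete `𝓘⁺`
from ALL origins of `X` (`Summit.FinalStateConjecture.HasCompleteNullInfinity`).
Proof: given `B̂₀` (from `𝒮`) put `B₀ := ι⁻¹ J⁺(σ B̂₀)` — compact (`J⁺(compact) ∩ Cauchy surface` is
compact in a globally hyperbolic development); given `s` take `B̂₁` for `s' := s ϰ / Λ` and `B₁` from
backward capture for `(B̂₀, B̂₁)`.  For a ray `γ` from `ι x`, `x ∉ B₁`: hit `γ t₀ = σ q`, `q ∈ A ∖ B̂₁`;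
`κ := −g(γ̇ t₀, νσ q)/Λ ∈ (0, ϰ/Λ]`; `γ̂ := χ⁻¹ ∘ (u ↦ γ(t₀ + u/κ))` on the component of the preimage of
`range χ` containing `0` is a MAXIMAL geodesic of `𝒮` (uniqueness + openness, as in 10054 TRIAGE F2),
null, future, and NORMALISED (`dχ ν' = Λ νσ` by uniqueness of the unit normal).  If `dom γ̂` is
unbounded so is `dom γ`; else its sojourn `≥ s'` in `J⁺_𝒮(ι' B̂₀)` maps under `χ` to parameters
`t ≥ t₀` of `γ` in `J⁺_𝒟(σ B̂₀)` of measure `≥ s'/κ ≥ s`, none of them in `[t₀, 0)` (capture clause),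
and for `t ≥ 0`, `γ t ∈ J⁺(σ B̂₀) ∩ J⁺(ι x) ⊆ J⁺(ι B₀)` (a causal curve from `σ b ∈ J⁻(ιX)` to a point of
`J⁺(ιX)` meets the acausal Cauchy surface `ι(X)`, inside `ι B₀`).  `sojournTime_mono(_left)`.
Why it might fail: only if a general causal fact used here were false for the prelude's typed notions
(compactness of `J⁺(K) ∩ ι(X)`; spacelike Cauchy ⇒ acausal; geodesic uniqueness) — all standard.
Leans on: `DataEmbedding.HasCompleteFutureNullInfinityFrom`, `Summit.FinalStateConjecture.HasCompleteNullInfinity`,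
`sojournTime_mono`, `sojournTime_mono_left`, `IsNormalisedNullRayFrom`, `mfderiv_normal_rel`
(`Theorems/SwallowTheDatumSubdataDevelopmentsEmbedRigidity`); print: O'Neill 1983 Ch. 14,
Christodoulou CQG 1999, Dafermos–Rodnianski arXiv:0811.0354 §2.6.2. -/
def Sig.stub_leafScriTransfer : Prop :=
  ∀ (X : Type) [TopologicalSpace X] [ChartedSpace E3 X] [IsManifold (𝓡 3) ∞ X]
    [T2Space X] [SecondCountableTopology X] [ConnectedSpace X]
    (D : InitialDataSet (𝓡 3) X) (𝒟 : CauchyDevelopment D)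
    (N : Type) [TopologicalSpace N] [ChartedSpace E3 N] [IsManifold (𝓡 3) ∞ N] [ConnectedSpace N]
    (D' : InitialDataSet (𝓡 3) N) (𝒮 : DataEmbedding D') (χ : 𝒮.carrier → 𝒟.carrier) (Λ : ℝ),
    0 < Λ →
    ContMDiff (𝓡 4) (𝓡 4) ∞ χ → Topology.IsOpenEmbedding χ →
    (∀ p, pullbackBilin (I := 𝓡 4) (I' := 𝓡 4) χ 𝒟.metric.val p = Λ ^ 2 • 𝒮.metric.val p) →
    𝒮.timeOrientation.PreservesTimeOrientation χ 𝒟.timeOrientation →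
    ∀ (σ : N → 𝒟.carrier) (νσ : NormalField (𝓡 4) σ), χ ∘ 𝒮.embed = σ →
      𝒟.metric.IsFutureUnitNormal (𝓡 3) 𝒟.timeOrientation σ νσ →
      ∀ (A : Set N), 𝒮.HasCompleteFutureNullInfinityFrom A →
        (∀ q : N, σ q ∈ 𝒟.metric.causalPast 𝒟.timeOrientation (Set.range 𝒟.embed)) →
        ∀ (ϰ : ℝ), 0 < ϰ →
          (∀ (K₀ K₁ : Set N), IsCompact K₀ → IsCompact K₁ →
            ∃ B₁ : Set X, IsCompact B₁ ∧ ∀ x : X, x ∉ B₁ →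
              ∀ [𝒟.metric.HasLeviCivita] (γ : ℝ → 𝒟.carrier) (dom : Set ℝ),
                𝒟.metric.IsNormalisedNullRayFrom 𝒟.timeOrientation 𝒟.embed 𝒟.normal x γ dom →
                ∃ t₀ ∈ dom, t₀ ≤ 0 ∧ ∃ q : N, q ∈ A ∧ q ∉ K₁ ∧ γ t₀ = σ q ∧
                  -(𝒟.metric.val (γ t₀) (velocity (𝓡 4) γ t₀) (νσ q)) ≤ ϰ ∧
                  ∀ t ∈ dom, t₀ ≤ t → t < 0 →
                    γ t ∉ 𝒟.metric.causalFuture 𝒟.timeOrientation (σ '' K₀)) →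
          Summit.FinalStateConjecture.HasCompleteNullInfinity 𝒟

/-- **Stub 5 — `stub_leafCapture` (the CERTIFICATE: slowly-rotating-Kerr stability at the reference
triple `(M, a, r₀) = (1, 0, 1)`, far-sojourn form; XL as mathematics, ONE LINE from either the
vendored Klainerman–Szeftel Cauchy fact `klainerman_szeftel_kerr_stability_small_a_cauchy`
(`leafCapture_of_KS` below) or the route's own rank-4 crux `BulkKerrCapture` at `a₁ = 0`
(`leafCapture_of_bulk` below) — both reductions kernel-checked in this file).**  There are exponents
`(s, δ)` and a tolerance `η > 0` such that every vacuum-constraint datum on `Kerr.slice 0 1` within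
`η` of `Kerr.data 1 0 1` in `H^s_δ × H^{s−1}_{δ+1}` has ALL its maximal vacuum Cauchy developments
with complete `𝓘⁺` as seen from the closed far region (`HasCompleteFutureNullInfinityFar`).  The first
conjunct, `Kerr.SliceFacts` (the six classical Kerr–Schild slice facts bundled by `KerrData.lean`), is
a THEOREM of the tree — `Kerr.sliceFacts_holds`, `Literature/Geometry/Lorentzian/KerrSliceFacts.lean` —
whose module was not yet built on the farm at filing (2026-08-16), so it cannot be imported here; it is
carried as a conjunct (discharge: `exact Kerr.sliceFacts_holds`) because the composition must
instantiate the reference datum `Kerr.data 1 0 1`.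
Why it might fail: it does not, short of a failure of Kerr stability at `a = 0` (Klainerman–Szeftel
2023 + GKS 2022 + Shen 2022; DHRT 2021 in symmetry classes); the typed risk is only that the vendored
paraphrase (far-origin sojourn form on truncated horizon-penetrating slices) over-reads the printed
theorem — audited twice (StabilityCauchy.lean module docstring; this crux's TRIAGE-r1-1/2).
Leans on: `Kerr.{slice, data}`, `InitialDataSet.dataWeightedSobolevEDist`,
`DataEmbedding.HasCompleteFutureNullInfinityFar`; print: KlainermanSzeftel2023 Thm 1.2.1 / §3.4.3,
arXiv:2205.14808, arXiv:2205.12336, arXiv:2104.08222. -/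
def Sig.stub_leafCapture : Prop :=
  Kerr.SliceFacts ∧
  ∀ [Kerr.Facts] [Kerr.SliceFacts], ∃ (s : ℕ) (δ : ℝ), ∃ η > (0 : ℝ),
    ∀ (D : InitialDataSet 𝓘(ℝ, E3) unitSlice) [D.metric.HasLeviCivita],
      D.IsVacuumConstraintSolution →
      InitialDataSet.dataWeightedSobolevEDist s δ D (Kerr.data 1 0 1 zero_le_one) < ENNReal.ofReal η →
      ∀ 𝒟 : VacuumCauchyDevelopment D, 𝒟.IsMaximal → 𝒟.HasCompleteFutureNullInfinityFar

/-! ## The registered stubs (`sorry` lives only in these five theorems) -/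

/-- **STUB 1** (XL; HARDEST): ε-tolerant burial — local smooth injective admissible families whose
members are near-Kerr collared at any prescribed tolerance. -/
theorem stub_collaredFamily : Sig.stub_collaredFamily := by
  sorry

/-- **STUB 2** (L): the shadow leaf, with acausality, causal-past and backward-capture clauses, in
every MGHD of an admissible collared datum (explicit Schwarzschild geometry + item 10053). -/
theorem stub_shadowLeaf : Sig.stub_shadowLeaf := by
  sorry

/-- **STUB 3** (L): generalised exterior ignorance in homothetic form, giving an embedded MAXIMAL
development of the leaf datum. -/
theorem stub_shadowDevelopment : Sig.stub_shadowDevelopment := by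
  sorry

/-- **STUB 4** (M–L): the slice-change transfer of far-sojourn completeness along a homothetic
embedding with backward capture. -/
theorem stub_leafScriTransfer : Sig.stub_leafScriTransfer := by
  sorry

/-- **STUB 5** (certificate): Kerr stability at `(1, 0, 1)` in far-sojourn Cauchy form — see
`leafCapture_of_KS` / `leafCapture_of_bulk` for the one-line reductions. -/
theorem stub_leafCapture : Sig.stub_leafCapture := by
  sorry

/-! ## The certificate is one line from the vendored fact, and from the route's rank-4 crux -/

theorem rMinus_one_zero : Kerr.rMinus 1 0 = 0 := by
  simp [Kerr.rMinus]

theorem rPlus_one_zero : Kerr.rPlus 1 0 = 2 := by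
  rw [Kerr.rPlus_zero_right zero_le_one]; norm_num

/-- The closed far region of the slice, as the range of `Kerr.farSliceIncl`, is the set of points of
norm `≥ R + 1` (the form inlined in `BulkKerrCapture` by the cone repair of 2026-08-15). -/
theorem range_farSliceIncl (a r₀ : ℝ) :
    Set.range (Kerr.farSliceIncl a r₀) =
      {q : Kerr.slice a r₀ | Kerr.afRadius a r₀ + 1 ≤ ‖(q : E3)‖} := by
  ext q
  constructor
  · rintro ⟨y, rfl⟩
    exact y.2
  · intro hq
    exact ⟨⟨(q : E3), hq⟩, Subtype.ext rfl⟩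

/-- **`stub_leafCapture` from the vendored Klainerman–Szeftel Cauchy fact** (sorry-free; the slice
facts `hSF` are the tree theorem `Kerr.sliceFacts_holds`): instantiate
`klainerman_szeftel_kerr_stability_small_a_cauchy` at `M = 1`, `a = 0` (`|0| < a₀`), `r₀ = 1 ∈ (r₋, r₊) = (0, 2)`
and project to the far-completeness conjunct. -/
theorem leafCapture_of_KS (hSF : Kerr.SliceFacts)
    (hKS : ∀ [Kerr.Facts] [Kerr.SliceFacts], klainerman_szeftel_kerr_stability_small_a_cauchy) :
    Sig.stub_leafCapture := by
  refine ⟨hSF, ?_⟩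
  intro _ _
  obtain ⟨s, δ, k, a₀, ha₀, H⟩ := hKS
  have ha : |(0 : ℝ)| < a₀ * 1 := by simpa using ha₀
  have hr : (1 : ℝ) ∈ Set.Ioo (Kerr.rMinus 1 0) (Kerr.rPlus 1 0) := by
    rw [rMinus_one_zero, rPlus_one_zero]; norm_num
  obtain ⟨ε, hε, C, HD⟩ := H 1 0 one_pos ha 1 hr
  refine ⟨s, δ, ε, hε, fun D _ hvac hdist 𝒟 hmax ↦ ?_⟩
  obtain ⟨M', a', 𝒟oc, -, hfar, -, -⟩ := HD D hvac hdist 𝒟 hmax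
  exact hfar

/-- **`stub_leafCapture` from the route's rank-4 crux `BulkKerrCapture`** (stmt-10696) at `a₁ = 0`,
`M = 1` (sorry-free): the card's point that, inside route PhaseMixingCapture, the censorship crux is
SUBORDINATE to bulk capture plus classical constructions.  The far-completeness conjunct of
`BulkKerrCapture` is the inlined body of `HasCompleteFutureNullInfinityFar` (`range_farSliceIncl`). -/
theorem leafCapture_of_bulk (hSF : Kerr.SliceFacts) (hB : BulkKerrCapture) : Sig.stub_leafCapture := by
  refine ⟨hSF, ?_⟩
  intro _ _
  obtain ⟨s, δ, k, H⟩ := hB 0 (by norm_num)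
  obtain ⟨ε, hε, C, H'⟩ := H 1 one_pos
  refine ⟨s, δ, ε, hε, fun D _ hvac hdist 𝒟 hmax ↦ ?_⟩
  have ha : |(0 : ℝ)| ≤ 0 * 1 := by simp
  obtain ⟨M', a', 𝒟oc, -, hfar, -, -⟩ := H' 0 ha D hvac hdist 𝒟 hmax
  rw [DataEmbedding.hasCompleteFutureNullInfinityFar_iff]
  intro _
  obtain ⟨B₀, hB₀, hs⟩ := hfar
  refine ⟨B₀, hB₀, fun σ hσ ↦ ?_⟩
  obtain ⟨B₁, hB₁, hq⟩ := hs σ hσ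
  refine ⟨B₁, hB₁, fun q hqA hqB γ dom hγ ↦ ?_⟩
  rw [range_farSliceIncl] at hqA
  exact hq q hqA hqB γ dom hγ

/-! ## The composition: the five stubs and the two shared items conclude the crux BY NAME -/

/-- `Kerr.Facts` is a theorem of the tree (assembled in `Theorems/SwallowTheDatumTargetGlue`); the slice
facts `Kerr.SliceFacts` are also a theorem (`Kerr.sliceFacts_holds`, module not yet built on the farm at
filing) and ride as the first conjunct of `Sig.stub_leafCapture`. -/
theorem kerrFacts : Kerr.Facts :=
  Summit.FinalStateConjecture.FinalStateConjecture.Theorems.SwallowTheDatum.kerrFacts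

/-- **`WeakCosmicCensorshipMGHD` from the five stubs, exterior ignorance for sub-data (item 10053)
and MGHD existence on admissible data (item 9937)** — real proof, no `sorry`.  For each `Σ = X`: local
families suffice (`isChristodoulouGeneric_one_of_local`); take `(s, δ, η)` from the certificate
(Stub 5) and the collared family through the exceptional admissible `d` (Stub 1); a small member
`F c`, `c ≠ 0`, is admissible, so it has an MGHD (9937), and for EVERY maximal `𝒟`: open the collar
chart, realise the shadow leaf (Stub 2), embed a maximal development `𝒟σ` of the normalised leaf
datum homothetically over it (Stub 3), certify `𝒟σ` far-complete (Stub 5: `D̂` is vacuum and in the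
ball), and transfer to all-origin completeness of `𝓘⁺` of `𝒟` (Stub 4). -/
theorem WeakCosmicCensorshipMGHD_of :
    Sig.stub_collaredFamily → Sig.stub_shadowLeaf → Sig.stub_shadowDevelopment →
      Sig.stub_leafScriTransfer → Sig.stub_leafCapture →
      SubdataDevelopmentsEmbed → MGHDExists → WeakCosmicCensorshipMGHD := by
  intro hFam hLeaf hDev hTr hCap hE hM X _ _ _ _ _ _
  haveI : Kerr.Facts := kerrFacts
  obtain ⟨hSF, hCap'⟩ := hCap
  haveI : Kerr.SliceFacts := hSF
  obtain ⟨s, δ, η, hη, hcap⟩ := hCap'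
  refine Summit.FinalStateConjecture.FinalStateConjecture.Theorems.PhotonSphereChannels.isChristodoulouGeneric_one_of_local
    fun d hd _ ↦ ?_
  obtain ⟨ε, F, hε, hF, h0, hinj, hadm, hcol⟩ := hFam s δ η hη X d hd
  refine ⟨ε, F, hε, hF, h0, hinj, hadm, fun c hc hcε ↦ ⟨hM X (F c) (hadm c hcε), fun 𝒟 hmax ↦ ?_⟩⟩
  obtain ⟨Λ, Rb, Φ, Dh, hchart, hvac, hdist⟩ := hcol c hc hcε
  have hΛ : 0 < Λ := hchart.1
  obtain ⟨σ, νσ, hE1, hE2, hE3, hE4, hE5, hpast, ϰ, hϰ, hSC⟩ :=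
    hLeaf hE X (F c) Λ Rb Φ Dh (hadm c hcε) hchart 𝒟 hmax
  obtain ⟨𝒟σ, hσmax, χ, hχs, hχo, hχh, hχτ, hχσ⟩ :=
    hDev X (F c) 𝒟 hmax unitSlice Dh σ νσ Λ hΛ hE1 hE2 hE3 hE4 hE5
  haveI : Dh.metric.HasLeviCivita := Dh.metric.hasLeviCivita
  have hfar : 𝒟σ.HasCompleteFutureNullInfinityFar := hcap Dh hvac hdist 𝒟σ hσmax
  rw [DataEmbedding.hasCompleteFutureNullInfinityFar_iff] at hfar
  have key := hTr X (F c) 𝒟.toCauchyDevelopment unitSlice Dh 𝒟σ.toDataEmbedding χ Λ hΛ hχs hχo hχh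
    hχτ σ νσ hχσ hE2 (Set.range (Kerr.farSliceIncl 0 1)) hfar hpast ϰ hϰ
  apply key
  intro K₀ K₁ hK₀ hK₁
  obtain ⟨B₁, hB₁, hx⟩ := hSC K₀ K₁ hK₀ hK₁
  refine ⟨B₁, hB₁, fun x hxB ↦ ?_⟩
  intro inst γ dom hγ
  exact @hx x hxB inst γ dom hγ

/-- The skeleton instantiated: the crux from the five registered stubs, modulo the two shared route
items it consumes by name (sorried through the stubs only). -/
theorem WeakCosmicCensorshipMGHD_skeleton (hE : SubdataDevelopmentsEmbed) (hM : MGHDExists) :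
    WeakCosmicCensorshipMGHD :=
  WeakCosmicCensorshipMGHD_of stub_collaredFamily stub_shadowLeaf stub_shadowDevelopment
    stub_leafScriTransfer stub_leafCapture hE hM

end Summit.FinalStateConjecture.FinalStateConjecture.Cruxes.WeakCosmicCensorshipMGHD.StabilityCertifiedBurial

end
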